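import Literature.NumberTheory.Transcendental.KZCubicalCalculus
import Literature.NumberTheory.Transcendental.SemialgebraicLineDeriv

/-!
# Route UnfoldedStokes — definitions posited by the route: fibrewise-Stokes decomposability

Crux `StokesGeneration` (stmt-KontsevichZagierPeriods-3586) of route UnfoldedStokes is kernel-checked equivalent to the
summit. Its line `fibrewise_stokes` (`Cruxes/StokesGeneration/Lines/fibrewise_stokes.lean`) reduces it to the residual S2
(`FibrewiseStokesGenerationConjecture`, `Theorems/FibrewiseStokesGenerationConjecture.lean`): every bounded closed-cube
integrand of value `0` is, after padding by dummy variables and off a null `ℚ`-semialgebraic set, a finite sum of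
FIBREWISE STOKES ELEMENTS `D − (G|_{xᵢ=1} − G|_{xᵢ=0})` — `G` bounded and `ℚ`-semialgebraic on the cube, continuous
along each closed coordinate-`i` fibre and differentiable along it off a `ℚ`-semialgebraic kink set with finite
`i`-fibres, `D` the fibre derivative. Every sector theorem of the line (rungs 1–6: Baker sector, dlog sector, angular
loops and the full angular sector, the rule-(2) relators of the interval and of the square, the dlog transposition)
concludes with this 15-line package verbatim. This file names it once — `FibStokesDecomposable M h` — so that the
closure properties of the class (sums, padding, coordinate permutations, products with functions of disjoint
variables) and future sectors can be stated in one line. No theorem of the tree is restated; the only lemma is the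
zero function (registered so that the file can land `--supports` the crux).

References: J. Ayoub, *Une version relative de la conjecture des périodes de Kontsevich–Zagier*, Ann. of Math. 181
(2015), Conj. 1.1, Rem. 1.5 (type-(a) elements `∂ᵢG − G|_{xᵢ=1} + G|_{xᵢ=0}`); J. Fresán, *Une introduction aux
périodes* (2024), Conj. 3.5, Rem. 3.7; M. Kontsevich, D. Zagier, *Periods* (2001), §1.2.
-/

noncomputable section

set_option linter.dupNamespace false

namespace Summit.KontsevichZagierPeriods.KontsevichZagierPeriods.Cruxes.StokesGeneration.FibrewiseStokes

open MeasureTheory Set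
open Literature.NumberTheory.Transcendental
open Literature.NumberTheory.Transcendental.KZ
open Literature.ModelTheory.ExponentialFields (IsSemialgebraic)

/-- **Fibrewise-Stokes decomposability** of a real function `h` on `ℝ^M` (read on the closed unit cube `[0,1]^M`):
there are a padding dimension `M' ≥ M`, finitely many FIBREWISE STOKES ELEMENTS on `[0,1]^{M'}` — directions `i j`,
primitives `G j` (bounded, `ℚ`-semialgebraic on the cube, continuous along each closed `i j`-fibre, differentiable
along it with derivative `D j` at interior points off the `ℚ`-semialgebraic kink set `K j`, which meets every
`i j`-fibre in finitely many points), carried by closed-cube representations `q j` with integrands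
`D j − (G j|_{x_{i j}=1} − G j|_{x_{i j}=0})` — and a null `ℚ`-semialgebraic set `Z` off which `h ∘ pr = Σ_j (q j).integrand`
(`pr` the projection to the first `M` coordinates). This is verbatim the conclusion of the residual S2
(`FibrewiseStokesGenerationConjecture`) of crux `StokesGeneration`, line `fibrewise_stokes`; Ayoub's type-(a) elements
transposed to the regularity class of the Kontsevich–Zagier calculus. [cite: Ayoub2015, Conj. 1.1, Rem. 1.5] -/
def FibStokesDecomposable (M : ℕ) (h : (Fin M → ℝ) → ℝ) : Prop :=
  ∃ (M' : ℕ) (hMM' : M ≤ M') (J : ℕ) (i : Fin J → Fin M') (G D : Fin J → (Fin M' → ℝ) → ℝ)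
    (K : Fin J → Set (Fin M' → ℝ)) (q : Fin J → IntegralRep M') (Z : Set (Fin M' → ℝ)),
    (∀ j, IsSemialgebraicFunOn ℚ (Set.pi Set.univ (fun _ : Fin M' => Set.Icc (0:ℝ) 1)) (G j) ∧
      IsSemialgebraicFunOn ℚ (Set.pi Set.univ (fun _ : Fin M' => Set.Icc (0:ℝ) 1)) (D j) ∧
      IsSemialgebraic ℚ (K j) ∧
      (∃ B : ℝ, ∀ x ∈ Set.pi Set.univ (fun _ : Fin M' => Set.Icc (0:ℝ) 1), |(G j) x| ≤ B) ∧
      (∀ x ∈ Set.pi Set.univ (fun _ : Fin M' => Set.Icc (0:ℝ) 1),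
        Set.Finite {s : ℝ | Function.update x (i j) s ∈ (K j)}) ∧
      (∀ x ∈ Set.pi Set.univ (fun _ : Fin M' => Set.Icc (0:ℝ) 1),
        ContinuousOn (fun s : ℝ => (G j) (Function.update x (i j) s)) (Set.Icc (0:ℝ) 1)) ∧
      (∀ x ∈ Set.pi Set.univ (fun _ : Fin M' => Set.Icc (0:ℝ) 1), x ∉ (K j) → x (i j) ∈ Set.Ioo (0:ℝ) 1 →
        HasDerivAt (fun s : ℝ => (G j) (Function.update x (i j) s)) ((D j) x) (x (i j)))) ∧
    (∀ j, (q j).domain = Set.pi Set.univ (fun _ : Fin M' => Set.Icc (0:ℝ) 1) ∧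
      ∀ x ∈ Set.pi Set.univ (fun _ : Fin M' => Set.Icc (0:ℝ) 1), (q j).integrand x =
        D j x - (G j (Function.update x (i j) 1) - G j (Function.update x (i j) 0))) ∧
    IsSemialgebraic ℚ Z ∧ volume Z = 0 ∧
    ∀ x ∈ Set.pi Set.univ (fun _ : Fin M' => Set.Icc (0:ℝ) 1), x ∉ Z →
      h (fun l => x (Fin.castLE hMM' l)) = ∑ j, (q j).integrand x

/-- The zero function is fibrewise-Stokes decomposable (no elements, no padding, empty null set). [folklore] -/
theorem fibStokesDecomposable_zero : ∀ (M : ℕ), FibStokesDecomposable M (fun _ => 0) := by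
  intro M
  refine ⟨M, le_rfl, 0, Fin.elim0, Fin.elim0, Fin.elim0, Fin.elim0, Fin.elim0, ∅, fun j => j.elim0,
    fun j => j.elim0, Literature.ModelTheory.ExponentialFields.isSemialgebraic_empty, measure_empty, ?_⟩
  intro x _ _
  simp

end Summit.KontsevichZagierPeriods.KontsevichZagierPeriods.Cruxes.StokesGeneration.FibrewiseStokes

end
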